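import Summits.QuantumFields.YangMills.Theorems.BalabanLadderNTReferencePackageTwoPoint
import Summits.QuantumFields.YangMills.Theorems.BalabanLadderNTReferencePackageThreePoint
import Summits.QuantumFields.YangMills.Theses.BalabanLadder
import HarnessLib

/-!
# Crux `NT` (stmt-QuantumFields-19353): reference-state transfer, VI — `LowerBounds` and the crux `BalabanLadder.NT`
# BY NAME from the REFERENCE PACKAGE (exterior-oscillation ceilings + floors with margin in ONE state per coupling)

Helper file (`--supports stmt-QuantumFields-19353`) of the fleet lead prover of crux `NT` (unit `ym-spine-19353-p1`,
g4).  Kernel-checks the composition `RefPackage ⇒ LowerBounds ⇒ NT` of the crux idea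
`Cruxes/NT/Ideas/reference-state-transfer.md` (crux-ideate seat `ym-cruxidea-19353-1`, g3; there
`lowerBounds_of_refPackage` was sorried and `nt_of_refPackage` proved modulo it), in a slightly MORE GENERAL and
SHARPER form:

* the reference state at coupling `β` is the kernel of the origin-centred cube of lattice radius `⌈ρ / a β⌉₊` with an
  ARBITRARY exterior `ηr β` (the card's cold wall `fun _ => 1` — Schrödinger-functional / Dirichlet data — is one
  choice; a maximally twisted or any other frozen exterior is equally admissible);
* the transfer margins are those of the oscillation-form laws of total covariance / cumulance (files I–II):
  two-point `2 h_{θv} h_v + w_{θv,v}` (card: `8 h h + w`), three-point per triple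
  `2 (k w_{yz} + k w_{xz} + k w_{xy} + k³) + ω₃` (card: `6 Σ h·w + 8 h³ + w₃` after factorisation) — a package
  proved with the card's margins satisfies these a fortiori;
* NO sign of the third cumulant: `|RQ3| ≥ ε + margin` in the reference state gives `|Q3| ≥ ε` on every torus.

`lowerBounds_of_referencePackage`: units + (E1-osc) + (E2-osc) + (E3-osc) + (R2) + (R3) ⇒ `LowerBounds G r a`
(both clauses, `Λ₅ = σ + κ + 1`); `nt_of_referencePackage`: the same for one `(r, a)` per compact simple `G` ⇒
`Summit.QuantumFields.YangMills.Theses.BalabanLadder.NT` BY NAME.  What the ENGINE owes under this currency: the three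
sign-free exterior-oscillation ceilings on femto cubes (the output format of a small/large-field expansion with boundary
data) and two floors in ONE explicit state per coupling — no `∀η` floor, no `∀L`, no window, no sign `σ`.

Refs: card `Cruxes/NT/Ideas/reference-state-transfer.md` (§Transfer `C⁺ := RefPackage`, D4, `nt_of_refPackage`);
route file `Theses/BalabanLadder.lean` (decl `NT`, item stmt-QuantumFields-19353).
-/

set_option autoImplicit false

noncomputable section

open scoped SchwartzMap
open MeasureTheory Filter Topology
open Literature.MathematicalPhysics.QuantumFieldTheory Literature.MathematicalPhysics.QuantumLattice
open Literature.Probability.LatticeModels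
open Summit.QuantumFields.YangMills.Cruxes.OSLegsFromFemtoAndGap.DlrCollarTransfer

namespace Summit.QuantumFields.YangMills.Cruxes.NT.Reference

section Package

variable (G : Type) [Group G] [TopologicalSpace G] [IsTopologicalGroup G] [CompactSpace G]
  [MeasurableSpace G] [BorelSpace G] (r : LatticeRep G)

/-- **`LowerBounds` from the reference package.**  A unit map `a` (`0 < a`, `a → 0`); constants `C₁, C₂, C₃ ≥ 0`,
femto scale `ℓ`, reference radius `ρ`, support radius `σ > 0`, collar `κ > 0` with `2(σ+κ) < ℓ`, `σ + κ < ρ`;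
reference exteriors `ηr β`; (E1/E2/E3-osc) the exterior-oscillation ceilings of the one/two/three-point kernel data
of the action density on femto cubes (depth decay `d⁻⁴`, separation decay `(1+‖·‖)⁻⁴` / `(1+min sep)⁻⁸`);
(R2) a reflected two-point floor and (R3) an unsigned three-point floor in the reference state, each beating `ε` plus
its explicit lattice transfer margin.  Then `LowerBounds G r a`. [folklore] -/
theorem lowerBounds_of_referencePackage (a : ℝ → ℝ) (ha₀ : ∀ β, 0 < a β) (ha : Tendsto a atTop (𝓝 0))
    {C₁ C₂ C₃ ℓ ρ σ κ : ℝ} (hC₁ : 0 ≤ C₁) (hC₂ : 0 ≤ C₂) (hC₃ : 0 ≤ C₃) (hσ : 0 < σ) (hκ : 0 < κ)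
    (hℓ : 2 * (σ + κ) < ℓ) (hρ : σ + κ < ρ) (ηr : ℝ → LGConfig 4 G)
    (hE1 : ∃ β₁ : ℝ, ∀ β : ℝ, β₁ ≤ β → ∀ (c : Fin 4 → ℤ) (b : ℕ), (b : ℝ) * a β ≤ ℓ →
      ∀ (η η' : LGConfig 4 G) (x : Fin 4 → ℤ), 1 ≤ depth c b x →
        |kerE G r β c b η (dens G r x) - kerE G r β c b η' (dens G r x)| ≤ C₁ / (depth c b x : ℝ) ^ 4)
    (hE2 : ∃ β₂ : ℝ, ∀ β : ℝ, β₂ ≤ β → ∀ (c : Fin 4 → ℤ) (b : ℕ), (b : ℝ) * a β ≤ ℓ →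
      ∀ (η η' : LGConfig 4 G) (x y : Fin 4 → ℤ), 1 ≤ depth c b x → 1 ≤ depth c b y →
        |kerCov G r β c b η (dens G r x) (dens G r y) - kerCov G r β c b η' (dens G r x) (dens G r y)| ≤
          C₂ / ((min (depth c b x) (depth c b y) : ℕ) : ℝ) ^ 4 / (1 + ‖siteToE (y - x)‖) ^ 4)
    (hE3 : ∃ β₃ : ℝ, ∀ β : ℝ, β₃ ≤ β → ∀ (c : Fin 4 → ℤ) (b : ℕ), (b : ℝ) * a β ≤ ℓ →
      ∀ (η η' : LGConfig 4 G) (x y z : Fin 4 → ℤ), 1 ≤ depth c b x → 1 ≤ depth c b y → 1 ≤ depth c b z →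
        |kerK3 G r β c b η x y z - kerK3 G r β c b η' x y z| ≤
          C₃ / ((min (min (depth c b x) (depth c b y)) (depth c b z) : ℕ) : ℝ) ^ 4 /
            (1 + min (min ‖siteToE (y - x)‖ ‖siteToE (z - y)‖) ‖siteToE (z - x)‖) ^ 8)
    (hR2 : ∃ (v : 𝓢(EuclideanSpace ℝ (Fin 4), ℝ)) (ε β₅ : ℝ),
      tsupport (v : EuclideanSpace ℝ (Fin 4) → ℝ) ⊆ {y | 0 < y 0} ∧
      tsupport (v : EuclideanSpace ℝ (Fin 4) → ℝ) ⊆ Metric.closedBall 0 σ ∧ 0 < ε ∧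
      ∀ β : ℝ, β₅ ≤ β →
        ε + 2 * (C₁ * (a β / κ) ^ 4 * ∑ x ∈ box 4 ⌈ρ / a β⌉₊, |thetaTest 4 v (a β • siteToE x)|) *
              (C₁ * (a β / κ) ^ 4 * ∑ y ∈ box 4 ⌈ρ / a β⌉₊, |v (a β • siteToE y)|) +
            C₂ * (a β / κ) ^ 4 * ∑ x ∈ box 4 ⌈ρ / a β⌉₊, ∑ y ∈ box 4 ⌈ρ / a β⌉₊,
              |thetaTest 4 v (a β • siteToE x)| * |v (a β • siteToE y)| / (1 + ‖siteToE (y - x)‖) ^ 4 ≤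
          ∑ x ∈ box 4 ⌈ρ / a β⌉₊, ∑ y ∈ box 4 ⌈ρ / a β⌉₊,
            thetaTest 4 v (a β • siteToE x) * v (a β • siteToE y) *
              kerCov G r β (fun _ => -(⌈ρ / a β⌉₊ : ℤ)) (2 * ⌈ρ / a β⌉₊ + 1) (ηr β) (dens G r x) (dens G r y))
    (hR3 : ∃ (f g h : 𝓢(EuclideanSpace ℝ (Fin 4), ℝ)) (ε β₅ : ℝ),
      Disjoint (tsupport (f : EuclideanSpace ℝ (Fin 4) → ℝ)) (tsupport (g : EuclideanSpace ℝ (Fin 4) → ℝ)) ∧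
      Disjoint (tsupport (g : EuclideanSpace ℝ (Fin 4) → ℝ)) (tsupport (h : EuclideanSpace ℝ (Fin 4) → ℝ)) ∧
      Disjoint (tsupport (f : EuclideanSpace ℝ (Fin 4) → ℝ)) (tsupport (h : EuclideanSpace ℝ (Fin 4) → ℝ)) ∧
      tsupport (f : EuclideanSpace ℝ (Fin 4) → ℝ) ⊆ Metric.closedBall 0 σ ∧
      tsupport (g : EuclideanSpace ℝ (Fin 4) → ℝ) ⊆ Metric.closedBall 0 σ ∧
      tsupport (h : EuclideanSpace ℝ (Fin 4) → ℝ) ⊆ Metric.closedBall 0 σ ∧ 0 < ε ∧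
      ∀ β : ℝ, β₅ ≤ β →
        ε + ∑ x ∈ box 4 ⌈ρ / a β⌉₊, ∑ y ∈ box 4 ⌈ρ / a β⌉₊, ∑ z ∈ box 4 ⌈ρ / a β⌉₊,
            |f (a β • siteToE x)| * |g (a β • siteToE y)| * |h (a β • siteToE z)| *
              (2 * ((C₁ * (a β / κ) ^ 4) * (C₂ * (a β / κ) ^ 4 / (1 + ‖siteToE (z - y)‖) ^ 4) +
                    (C₁ * (a β / κ) ^ 4) * (C₂ * (a β / κ) ^ 4 / (1 + ‖siteToE (z - x)‖) ^ 4) +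
                    (C₁ * (a β / κ) ^ 4) * (C₂ * (a β / κ) ^ 4 / (1 + ‖siteToE (y - x)‖) ^ 4) +
                    (C₁ * (a β / κ) ^ 4) * (C₁ * (a β / κ) ^ 4) * (C₁ * (a β / κ) ^ 4)) +
                C₃ * (a β / κ) ^ 4 / (1 + min (min ‖siteToE (y - x)‖ ‖siteToE (z - y)‖) ‖siteToE (z - x)‖) ^ 8) ≤
          |∑ x ∈ box 4 ⌈ρ / a β⌉₊, ∑ y ∈ box 4 ⌈ρ / a β⌉₊, ∑ z ∈ box 4 ⌈ρ / a β⌉₊,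
            f (a β • siteToE x) * g (a β • siteToE y) * h (a β • siteToE z) *
              kerK3 G r β (fun _ => -(⌈ρ / a β⌉₊ : ℤ)) (2 * ⌈ρ / a β⌉₊ + 1) (ηr β) x y z|) :
    LowerBounds G r a :=
  ⟨lowerBounds_fst_of_reference G r a ha₀ ha hC₁ hC₂ hσ hκ hℓ hρ ηr hE1 hE2 hR2,
    lowerBounds_snd_of_reference G r a ha₀ ha hC₁ hC₂ hC₃ hσ hκ hℓ hρ ηr hE1 hE2 hE3 hR3⟩

end Package

/-- **The crux `BalabanLadder.NT` BY NAME from the reference package** — for every compact simple `G` (Borel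
σ-algebra) one lattice representation `r`, one unit map `a` (`0 < a`, `a → 0`) and the data of
`lowerBounds_of_referencePackage` (constants, reference exteriors, the three sign-free exterior-oscillation ceilings
on femto cubes, the two reference floors with margin).  This is the card `reference-state-transfer`'s
`nt_of_refPackage` with its sorried bookkeeping discharged (reference exterior generalised, margins sharpened,
cumulant unsigned).  Nothing here is an estimate on Yang–Mills: the five engine items remain the hypothesis. [folklore] -/
theorem nt_of_referencePackage
    (h : ∀ (G : Type) [Group G] [TopologicalSpace G] [IsTopologicalGroup G] [CompactSpace G],
      IsCompactSimpleLieGroup G → letI : MeasurableSpace G := borel G; haveI : BorelSpace G := ⟨rfl⟩;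
      ∃ (r : LatticeRep G) (a : ℝ → ℝ), (∀ β, 0 < a β) ∧ Tendsto a atTop (𝓝 0) ∧
      ∃ (C₁ C₂ C₃ ℓ ρ σ κ : ℝ) (ηr : ℝ → LGConfig 4 G), 0 ≤ C₁ ∧ 0 ≤ C₂ ∧ 0 ≤ C₃ ∧ 0 < σ ∧ 0 < κ ∧
        2 * (σ + κ) < ℓ ∧ σ + κ < ρ ∧
      (∃ β₁ : ℝ, ∀ β : ℝ, β₁ ≤ β → ∀ (c : Fin 4 → ℤ) (b : ℕ), (b : ℝ) * a β ≤ ℓ →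
        ∀ (η η' : LGConfig 4 G) (x : Fin 4 → ℤ), 1 ≤ depth c b x →
          |kerE G r β c b η (dens G r x) - kerE G r β c b η' (dens G r x)| ≤ C₁ / (depth c b x : ℝ) ^ 4) ∧
      (∃ β₂ : ℝ, ∀ β : ℝ, β₂ ≤ β → ∀ (c : Fin 4 → ℤ) (b : ℕ), (b : ℝ) * a β ≤ ℓ →
        ∀ (η η' : LGConfig 4 G) (x y : Fin 4 → ℤ), 1 ≤ depth c b x → 1 ≤ depth c b y →
          |kerCov G r β c b η (dens G r x) (dens G r y) - kerCov G r β c b η' (dens G r x) (dens G r y)| ≤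
            C₂ / ((min (depth c b x) (depth c b y) : ℕ) : ℝ) ^ 4 / (1 + ‖siteToE (y - x)‖) ^ 4) ∧
      (∃ β₃ : ℝ, ∀ β : ℝ, β₃ ≤ β → ∀ (c : Fin 4 → ℤ) (b : ℕ), (b : ℝ) * a β ≤ ℓ →
        ∀ (η η' : LGConfig 4 G) (x y z : Fin 4 → ℤ), 1 ≤ depth c b x → 1 ≤ depth c b y → 1 ≤ depth c b z →
          |kerK3 G r β c b η x y z - kerK3 G r β c b η' x y z| ≤
            C₃ / ((min (min (depth c b x) (depth c b y)) (depth c b z) : ℕ) : ℝ) ^ 4 /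
              (1 + min (min ‖siteToE (y - x)‖ ‖siteToE (z - y)‖) ‖siteToE (z - x)‖) ^ 8) ∧
      (∃ (v : 𝓢(EuclideanSpace ℝ (Fin 4), ℝ)) (ε β₅ : ℝ),
        tsupport (v : EuclideanSpace ℝ (Fin 4) → ℝ) ⊆ {y | 0 < y 0} ∧
        tsupport (v : EuclideanSpace ℝ (Fin 4) → ℝ) ⊆ Metric.closedBall 0 σ ∧ 0 < ε ∧
        ∀ β : ℝ, β₅ ≤ β →
          ε + 2 * (C₁ * (a β / κ) ^ 4 * ∑ x ∈ box 4 ⌈ρ / a β⌉₊, |thetaTest 4 v (a β • siteToE x)|) *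
                (C₁ * (a β / κ) ^ 4 * ∑ y ∈ box 4 ⌈ρ / a β⌉₊, |v (a β • siteToE y)|) +
              C₂ * (a β / κ) ^ 4 * ∑ x ∈ box 4 ⌈ρ / a β⌉₊, ∑ y ∈ box 4 ⌈ρ / a β⌉₊,
                |thetaTest 4 v (a β • siteToE x)| * |v (a β • siteToE y)| / (1 + ‖siteToE (y - x)‖) ^ 4 ≤
            ∑ x ∈ box 4 ⌈ρ / a β⌉₊, ∑ y ∈ box 4 ⌈ρ / a β⌉₊,
              thetaTest 4 v (a β • siteToE x) * v (a β • siteToE y) *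
                kerCov G r β (fun _ => -(⌈ρ / a β⌉₊ : ℤ)) (2 * ⌈ρ / a β⌉₊ + 1) (ηr β) (dens G r x) (dens G r y)) ∧
      (∃ (f g h : 𝓢(EuclideanSpace ℝ (Fin 4), ℝ)) (ε β₅ : ℝ),
        Disjoint (tsupport (f : EuclideanSpace ℝ (Fin 4) → ℝ)) (tsupport (g : EuclideanSpace ℝ (Fin 4) → ℝ)) ∧
        Disjoint (tsupport (g : EuclideanSpace ℝ (Fin 4) → ℝ)) (tsupport (h : EuclideanSpace ℝ (Fin 4) → ℝ)) ∧
        Disjoint (tsupport (f : EuclideanSpace ℝ (Fin 4) → ℝ)) (tsupport (h : EuclideanSpace ℝ (Fin 4) → ℝ)) ∧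
        tsupport (f : EuclideanSpace ℝ (Fin 4) → ℝ) ⊆ Metric.closedBall 0 σ ∧
        tsupport (g : EuclideanSpace ℝ (Fin 4) → ℝ) ⊆ Metric.closedBall 0 σ ∧
        tsupport (h : EuclideanSpace ℝ (Fin 4) → ℝ) ⊆ Metric.closedBall 0 σ ∧ 0 < ε ∧
        ∀ β : ℝ, β₅ ≤ β →
          ε + ∑ x ∈ box 4 ⌈ρ / a β⌉₊, ∑ y ∈ box 4 ⌈ρ / a β⌉₊, ∑ z ∈ box 4 ⌈ρ / a β⌉₊,
              |f (a β • siteToE x)| * |g (a β • siteToE y)| * |h (a β • siteToE z)| *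
                (2 * ((C₁ * (a β / κ) ^ 4) * (C₂ * (a β / κ) ^ 4 / (1 + ‖siteToE (z - y)‖) ^ 4) +
                      (C₁ * (a β / κ) ^ 4) * (C₂ * (a β / κ) ^ 4 / (1 + ‖siteToE (z - x)‖) ^ 4) +
                      (C₁ * (a β / κ) ^ 4) * (C₂ * (a β / κ) ^ 4 / (1 + ‖siteToE (y - x)‖) ^ 4) +
                      (C₁ * (a β / κ) ^ 4) * (C₁ * (a β / κ) ^ 4) * (C₁ * (a β / κ) ^ 4)) +
                  C₃ * (a β / κ) ^ 4 /
                    (1 + min (min ‖siteToE (y - x)‖ ‖siteToE (z - y)‖) ‖siteToE (z - x)‖) ^ 8) ≤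
            |∑ x ∈ box 4 ⌈ρ / a β⌉₊, ∑ y ∈ box 4 ⌈ρ / a β⌉₊, ∑ z ∈ box 4 ⌈ρ / a β⌉₊,
              f (a β • siteToE x) * g (a β • siteToE y) * h (a β • siteToE z) *
                kerK3 G r β (fun _ => -(⌈ρ / a β⌉₊ : ℤ)) (2 * ⌈ρ / a β⌉₊ + 1) (ηr β) x y z|)) :
    Summit.QuantumFields.YangMills.Theses.BalabanLadder.NT := by
  intro G _ _ _ _ hG
  letI : MeasurableSpace G := borel G
  haveI : BorelSpace G := ⟨rfl⟩
  obtain ⟨r, a, ha₀, ha, C₁, C₂, C₃, ℓ, ρ, σ, κ, ηr, hC₁, hC₂, hC₃, hσ, hκ, hℓ, hρ, hE1, hE2, hE3, hR2, hR3⟩ :=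
    h G hG
  exact ⟨r, a, ha₀, ha, lowerBounds_of_referencePackage G r a ha₀ ha hC₁ hC₂ hC₃ hσ hκ hℓ hρ ηr hE1 hE2 hE3 hR2 hR3⟩

end Summit.QuantumFields.YangMills.Cruxes.NT.Reference

end
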